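import Mathlib
import Summits.ResolutionOfSingularities.ResolutionOfSingularities.Theorems.RadicialJungCleanModelsCleanProp44SigmaTowerSuccessor
import Summits.ResolutionOfSingularities.ResolutionOfSingularities.Theorems.RadicialJungCleanModelsCleanProp44LocalizationInvert
import HarnessLib

/-!
# Route `RadicialJung`, crux `CleanModels` (stmt-ResolutionOfSingularities-15917), line `Sketch` rev 35, stub 6 `stub_cleanProp44` (X44c):
# THE TOP STOREY OF THE σ-TOWER — the exceptional divisor read at a point OFF the strict transform of the leaf (the births `c′ ∈ Γ″` and the generic point
# `η″` of the near curve), and STEP 1 end to end with the honest top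

Seat decomp-res-hand-2 g23 (structural hand); sequel of ✓ `…SigmaTower`, ✓ `…SigmaTowerSuccessor`, ✓ `…LocalizationInvert`.  The chained tower
✓ `sigmaTower` follows points of the strict transforms of the leaf (`t_{j+1} ∈ 𝔪`), which is right for every level BELOW the top (`z_{j+1} ∈ Z_j ⊂ L̃`),
but the top point — a birth `c′ ∈ Γ″ = {T + λ(u) = 0}` or the generic point `η″` of `Γ″` — lies on the leaf only when `λ(P) = 0`.  What the top storey must
deliver is only the `K[T]`-localization of `S = 𝒪_{x′}/(τ♯v)` with `T ↦ t′`, `τ♯t = τ♯v·t′` (the point has a finite `T`-coordinate, i.e. lies in the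
`v`-chart — automatic on `Γ″`).  The tree's chart lemma may present `S` through either chart; ✓ `exists_isLocalization_of_mul_X_eq_one` makes the choice
irrelevant (`s = v/t = t′⁻¹` in the other chart):

* `topStep_of_isBlowup` — for `(t, v) = J_x` part of a regular system of parameters and ANY `t′` with `τ♯t = τ♯v·t′`: `τ♯v` is a non-zero-divisor,
  `𝒪_{x′}/(τ♯v)` is local, and every `K[T]`-structure on it compatible with a localization structure `K → 𝒪_x/(t,v)` and with `T ↦ t′` is a localization
  of `K[T]` at some submonoid.
* `sigmaTower_topStep` — the same in the transportable form of ✓ `sigmaTower_step` (ring isomorphism `e`, composites `Ψ`), WITHOUT `t″ ∈ 𝔪`.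
* `sigmaTower_top` — ✓ `sigmaTower_inv` below the top + `sigmaTower_topStep`: the `K[T]`-localization of the exceptional divisor at an ARBITRARY point of the
  `v`-chart over the tower (hypothesis `ht𝔪` only for the levels `j < d`, the top relation `ψ_d t_d = v_{d+1} t_{d+1}` with no condition on `t_{d+1}`).
* `sigmaTower_successor_top` — ✓ `sigmaTower_successor` with the honest top (STEP 1 of the `δ`-descent at `η″`).

Honest framing: OURS, bookkeeping; with this file the census (S1)+(S2) chain needs from the termination author only the instantiation; nothing here proves X44c,
any case of `CleanModels`, or resolution of singularities in characteristic `p`. [cite: StacksProject, Tag 0804, Tag 0BIQ] [cite: Matsumura1987, Thm. 4.1–4.3,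
Thm. 14.2] [cite: CossartPiltant2008, Lemma 4.3 (5); Prop. 4.4 (proof, p. 11)] [cite: CossartJannsenSaito2020, Lemma 7.5]
-/

noncomputable section

set_option linter.dupNamespace false -- mandated namespace of this single-conjunct summit

open IsLocalRing CategoryTheory AlgebraicGeometry Polynomial
open Literature.AlgebraicGeometry.Resolution

namespace Summit.ResolutionOfSingularities.ResolutionOfSingularities.Theorems.RadicialJung.CleanModels

universe u

/-! ## §1 The top storey on the stalks of a blowing up -/

section TopStep

variable {Z Z' : Scheme.{u}} {τ : Z' ⟶ Z} {J : Z.IdealSheafData}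

set_option maxHeartbeats 800000 in
-- long statement, two chart cases with transports
/-- **THE TOP STOREY** (see the module docstring): centre `(c 0, c 1) = (t, v) = J_x`, `(c, w)` a regular system of parameters of `𝒪_{Z,x}`, `x′` over `x`
with a finite `T`-coordinate `t′` (`τ♯t = τ♯v · t′`, no condition `t′ ∈ 𝔪`). [cite: StacksProject, Tag 0804, Tag 0BIQ] [cite: Matsumura1987, Thm. 4.1–4.3] -/
theorem topStep_of_isBlowup (hτ : IsBlowup τ J) (x' : Z') (hR : IsRegularLocalRing (Z.presheaf.stalk (τ x'))) {l : ℕ}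
    (c : Fin 2 → Z.presheaf.stalk (τ x')) (w : Fin l → Z.presheaf.stalk (τ x'))
    (hz : Ideal.span (Set.range (Fin.append c w)) = maximalIdeal (Z.presheaf.stalk (τ x')))
    (hdim : ringKrullDim (Z.presheaf.stalk (τ x')) = ((2 + l : ℕ) : WithBot ℕ∞))
    (hcJ : Ideal.span (Set.range c) = stalkIdeal J (τ x'))
    (t' : Z'.presheaf.stalk x') (ht' : (τ.stalkMap x').hom (c 0) = (τ.stalkMap x').hom (c 1) * t') :
    (τ.stalkMap x').hom (c 1) ∈ nonZeroDivisors (Z'.presheaf.stalk x') ∧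
      IsLocalRing (Z'.presheaf.stalk x' ⧸ Ideal.span {(τ.stalkMap x').hom (c 1)}) ∧
      (∀ (K : Type u) [CommRing K] [Algebra K (Z.presheaf.stalk (τ x') ⧸ Ideal.span (Set.range c))] (M₀ : Submonoid K)
        [IsLocalization M₀ (Z.presheaf.stalk (τ x') ⧸ Ideal.span (Set.range c))]
        (inst : Algebra K[X] (Z'.presheaf.stalk x' ⧸ Ideal.span {(τ.stalkMap x').hom (c 1)})),
        (∀ (g : K) (r : Z.presheaf.stalk (τ x')), Ideal.Quotient.mk _ r = algebraMap K (Z.presheaf.stalk (τ x') ⧸ Ideal.span (Set.range c)) g →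
          algebraMap K[X] (Z'.presheaf.stalk x' ⧸ Ideal.span {(τ.stalkMap x').hom (c 1)}) (C g) =
            Ideal.Quotient.mk _ ((τ.stalkMap x').hom r)) →
        algebraMap K[X] (Z'.presheaf.stalk x' ⧸ Ideal.span {(τ.stalkMap x').hom (c 1)}) Polynomial.X = Ideal.Quotient.mk _ t' →
        ∃ N : Submonoid K[X], IsLocalization N (Z'.presheaf.stalk x' ⧸ Ideal.span {(τ.stalkMap x').hom (c 1)})) := by
  obtain ⟨i, uf, hrel, hufi, hloc, -, hX⟩ := exists_chart_localization_of_isBlowup hτ x' hR c w hz hdim hcJ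
  -- `τ♯v` is a non-zero-divisor (relations of the `v`-chart with the prescribed `t′`)
  have hrel1 : ∀ k, (τ.stalkMap x').hom (c k) = (τ.stalkMap x').hom (c 1) * (![t', 1] : Fin 2 → Z'.presheaf.stalk x') k := by
    intro k
    rcases Fin.exists_fin_two.mp ⟨k, rfl⟩ with h | h <;> rw [h]
    · exact ht'
    · simp
  have hnzd := stalkMap_mem_nonZeroDivisors_of_isBlowup hτ x' c hcJ 1 ![t', 1] hrel1
  -- which chart?
  rcases Fin.exists_fin_two.mp ⟨i, rfl⟩ with hi | hi
  · -- the `t`-chart: `s = uf 1 = v/t` with `t′ s = 1`; both exceptional ideals agree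
    subst hi
    have hts : t' * uf 1 = 1 := by
      apply (mul_cancel_left_mem_nonZeroDivisors hnzd).mp
      rw [mul_one, ← mul_assoc, ← ht', ← hrel 1]
    have hI : Ideal.span {(τ.stalkMap x').hom (c 0)} = Ideal.span {(τ.stalkMap x').hom (c 1)} := by
      apply le_antisymm
      · rw [Ideal.span_singleton_le_span_singleton]; exact ⟨t', ht'⟩
      · rw [Ideal.span_singleton_le_span_singleton]; exact ⟨uf 1, hrel 1⟩
    have hK0 : Ideal.span {(τ.stalkMap x').hom (c 0)} =
        Ideal.span {(τ.stalkMap x').hom (c 0)} ⊔ Ideal.span ((fun j : {j : Fin 2 // j ≠ 0} => uf j.1) '' ∅) := by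
      rw [Set.image_empty, Ideal.span_empty, sup_bot_eq]
    have hloc0 := hloc ∅ _ hK0 (fun j hj => absurd hj (Set.notMem_empty j))
    refine ⟨hnzd, ?_, fun K _ _ M₀ _ inst hKC hKX => ?_⟩
    · haveI := hloc0; exact (Ideal.quotEquivOfEq hI).isLocalRing
    · set e := Ideal.quotEquivOfEq hI with he
      have hesymm : ∀ a, e.symm (Ideal.Quotient.mk _ a) = Ideal.Quotient.mk _ a := fun a => by
        rw [he, Ideal.quotEquivOfEq_symm, Ideal.quotEquivOfEq_mk]
      -- the two `K[X]`-structures, read on `Q₀ = 𝒪′/(τ♯t)`: `φ₂⁰ = e⁻¹ ∘ algebraMap` (`X ↦ t′`) and `φ₁⁰` (`X ↦ s`)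
      set φ₂ : K[X] →+* Z'.presheaf.stalk x' ⧸ Ideal.span {(τ.stalkMap x').hom (c 1)} := algebraMap K[X] _ with hφ₂
      set φ₂0 : K[X] →+* Z'.presheaf.stalk x' ⧸ Ideal.span {(τ.stalkMap x').hom (c 0)} := (e.symm : _ →+* _).comp φ₂ with hφ₂0
      set φ₁0 : K[X] →+* Z'.presheaf.stalk x' ⧸ Ideal.span {(τ.stalkMap x').hom (c 0)} :=
        eval₂RingHom (φ₂0.comp C) (Ideal.Quotient.mk _ (uf 1)) with hφ₁0
      have hφ₂0 : ∀ q, φ₂0 q = e.symm (φ₂ q) := fun q => rfl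
      have hφ₁C : ∀ a : K, φ₁0 (C a) = φ₂0 (C a) := fun a => by rw [hφ₁0, coe_eval₂RingHom, eval₂_C, RingHom.comp_apply]
      have hφ₁X : φ₁0 Polynomial.X = Ideal.Quotient.mk _ (uf 1) := by rw [hφ₁0, coe_eval₂RingHom, eval₂_X]
      have hφ₂X : φ₂0 Polynomial.X = Ideal.Quotient.mk _ t' := by rw [hφ₂0, hφ₂, hKX, hesymm]
      have hmul : φ₁0 Polynomial.X * φ₂0 Polynomial.X = 1 := by
        rw [hφ₁X, hφ₂X, ← map_mul, mul_comm, hts, map_one]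
      -- `φ₁⁰` is a localization structure: the chart clause on `𝒪′/(τ♯t)`
      obtain ⟨N, hN⟩ := hX ∅ _ hK0 ⟨1, by decide⟩ (Set.notMem_empty _) (fun j _ => by
          obtain ⟨j, hj⟩ := j
          have : j = 1 := by
            rcases Fin.exists_fin_two.mp ⟨j, rfl⟩ with h | h
            · exact absurd h hj
            · exact h
          subst this; rfl)
        K M₀ φ₁0.toAlgebra
        (fun g r hgr => by
          show φ₁0 (C g) = _
          rw [hφ₁C, hφ₂0, hφ₂, hKC g r hgr, hesymm])
        (by show φ₁0 Polynomial.X = _; rw [hφ₁X])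
      -- hence so is `φ₂⁰` (✓ `exists_isLocalization_of_mul_X_eq_one`), and transport back along `e`
      obtain ⟨N₂, hN₂⟩ := exists_isLocalization_of_mul_X_eq_one φ₁0 φ₂0 hφ₁C hmul N hN
      letI inst0 : Algebra K[X] (Z'.presheaf.stalk x' ⧸ Ideal.span {(τ.stalkMap x').hom (c 0)}) := φ₂0.toAlgebra
      have halg0 : ∀ q, algebraMap K[X] (Z'.presheaf.stalk x' ⧸ Ideal.span {(τ.stalkMap x').hom (c 0)}) q = e.symm (φ₂ q) := fun q => rfl
      let ea : (Z'.presheaf.stalk x' ⧸ Ideal.span {(τ.stalkMap x').hom (c 0)}) ≃ₐ[K[X]]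
          (Z'.presheaf.stalk x' ⧸ Ideal.span {(τ.stalkMap x').hom (c 1)}) :=
        { e with
          commutes' := fun q => by
            change e (algebraMap K[X] _ q) = φ₂ q
            rw [halg0, RingEquiv.apply_symm_apply] }
      exact ⟨N₂, @IsLocalization.isLocalization_of_algEquiv K[X] _ N₂ _ _ _ _ _ inst hN₂ ea⟩
  · -- the `v`-chart: `uf 0 = t′`
    subst hi
    have huf0 : uf 0 = t' := (mul_cancel_left_mem_nonZeroDivisors hnzd).mp (by rw [← hrel 0, ht'])
    have hK1 : Ideal.span {(τ.stalkMap x').hom (c 1)} =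
        Ideal.span {(τ.stalkMap x').hom (c 1)} ⊔ Ideal.span ((fun j : {j : Fin 2 // j ≠ 1} => uf j.1) '' ∅) := by
      rw [Set.image_empty, Ideal.span_empty, sup_bot_eq]
    refine ⟨hnzd, hloc ∅ _ hK1 (fun j hj => absurd hj (Set.notMem_empty j)), fun K _ _ M₀ _ inst hKC hKX => ?_⟩
    exact hX ∅ _ hK1 ⟨0, by decide⟩ (Set.notMem_empty _) (fun j _ => by
        obtain ⟨j, hj⟩ := j
        have : j = 0 := by
          rcases Fin.exists_fin_two.mp ⟨j, rfl⟩ with h | h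
          · exact h
          · exact absurd h hj
        subst this; rfl)
      K M₀ inst hKC (by rw [hKX, huf0])

end TopStep

/-! ## §2 The top storey in transportable form -/

section TopTransport

variable {Z Z' : Scheme.{u}} {τ : Z' ⟶ Z} {J : Z.IdealSheafData}

set_option maxHeartbeats 800000 in
-- long statement; elaboration only
/-- **THE TOP STOREY, TRANSPORTABLE FORM**: the data of ✓ `sigmaTower_step` WITHOUT `t″ ∈ 𝔪`; conclusions: `v″` is a non-zero-divisor, `A″/(v″)` is local,
and every `K[T]`-structure on `A″/(v″)` compatible with the base through `Ψ″` and with `T ↦ t″` is a localization of `K[T]`.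
[cite: StacksProject, Tag 0804, Tag 0BIQ] [cite: Matsumura1987, Thm. 4.1–4.3] -/
theorem sigmaTower_topStep (hτ : IsBlowup τ J) (x' : Z') (t v : Z.presheaf.stalk (τ x')) (hrs : IsRsopPart ![t, v])
    (hcJ : Ideal.span (Set.range ![t, v]) = stalkIdeal J (τ x'))
    {A'' : Type u} [CommRing A''] [IsLocalRing A''] (e : Z'.presheaf.stalk x' ≃+* A'')
    (ψ : Z.presheaf.stalk (τ x') →+* A'') (hψ : ∀ r, ψ r = e ((τ.stalkMap x').hom r))
    (t'' v'' : A'') (hv : ψ v = v'') (ht : ψ t = v'' * t'')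
    {K : Type u} [CommRing K] (M₀ : Submonoid K) {A₀ : Type u} [CommRing A₀] (I₀ : Ideal A₀) (Λ₀ : K →+* A₀ ⧸ I₀)
    (Ψ : A₀ →+* Z.presheaf.stalk (τ x')) (Ψ'' : A₀ →+* A'') (hΨ'' : ∀ r, Ψ'' r = ψ (Ψ r))
    (inst : Algebra K (Z.presheaf.stalk (τ x') ⧸ Ideal.span (Set.range ![t, v])))
    (hcompat : ∀ (g : K) (r₀ : A₀), Λ₀ g = Ideal.Quotient.mk I₀ r₀ →
      @algebraMap K (Z.presheaf.stalk (τ x') ⧸ Ideal.span (Set.range ![t, v])) _ _ inst g = Ideal.Quotient.mk _ (Ψ r₀))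
    (hloc : @IsLocalization K _ M₀ (Z.presheaf.stalk (τ x') ⧸ Ideal.span (Set.range ![t, v])) _ inst) :
    v'' ∈ nonZeroDivisors A'' ∧ IsLocalRing (A'' ⧸ Ideal.span {v''}) ∧
      (∀ instE : Algebra K[X] (A'' ⧸ Ideal.span {v''}),
        (∀ (g : K) (r₀ : A₀), Λ₀ g = Ideal.Quotient.mk I₀ r₀ →
          @algebraMap K[X] (A'' ⧸ Ideal.span {v''}) _ _ instE (C g) = Ideal.Quotient.mk _ (Ψ'' r₀)) →
        @algebraMap K[X] (A'' ⧸ Ideal.span {v''}) _ _ instE Polynomial.X = Ideal.Quotient.mk _ t'' →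
        ∃ N : Submonoid K[X], @IsLocalization K[X] _ N (A'' ⧸ Ideal.span {v''}) _ instE) := by
  letI := inst
  haveI := hloc
  obtain ⟨hR, l, w, hz, hdim⟩ := IsRsopPart.exists_append_eq_maximalIdeal hrs
  set t' : Z'.presheaf.stalk x' := e.symm t'' with ht'def
  have het' : e t' = t'' := by rw [ht'def, e.apply_symm_apply]
  have hev : e ((τ.stalkMap x').hom v) = v'' := by rw [← hψ, hv]
  have ht' : (τ.stalkMap x').hom (![t, v] 0) = (τ.stalkMap x').hom (![t, v] 1) * t' := by
    apply e.injective
    change e ((τ.stalkMap x').hom t) = e ((τ.stalkMap x').hom v * t')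
    rw [map_mul, het', hev, ← hψ, ht]
  obtain ⟨hnzd, hlocE, hE⟩ := topStep_of_isBlowup hτ x' hR ![t, v] w hz hdim hcJ t' ht'
  have hIE : Ideal.span {v''} = (Ideal.span {(τ.stalkMap x').hom (![t, v] 1)}).map (e : Z'.presheaf.stalk x' →+* A'') :=
    (map_span_singleton_eq e _ v'' hev).symm
  set eE := Ideal.quotientEquiv _ _ e hIE with heE
  have heEsymm : ∀ a, eE.symm (Ideal.Quotient.mk _ a) = Ideal.Quotient.mk _ (e.symm a) := fun a => Ideal.quotientEquiv_symm_mk _ _ e hIE a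
  have hleE : Ideal.span (Set.range ![t, v]) ≤ (Ideal.span {(τ.stalkMap x').hom (![t, v] 1)}).comap (τ.stalkMap x').hom := by
    rw [Ideal.span_le]
    rintro _ ⟨k, rfl⟩
    rw [SetLike.mem_coe, Ideal.mem_comap]
    rcases Fin.exists_fin_two.mp ⟨k, rfl⟩ with h | h <;> rw [h]
    · rw [ht']; exact Ideal.mul_mem_right _ _ (Ideal.mem_span_singleton_self _)
    · exact Ideal.mem_span_singleton_self _
  have hrep : ∀ g : K, ∃ r₀ : A₀, Λ₀ g = Ideal.Quotient.mk I₀ r₀ := fun g => by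
    obtain ⟨r₀, hr₀⟩ := Ideal.Quotient.mk_surjective (Λ₀ g); exact ⟨r₀, hr₀.symm⟩
  refine ⟨by rw [← hev]; exact mem_nonZeroDivisors_ringEquiv e hnzd, by haveI := hlocE; exact eE.isLocalRing, fun instE hcompatE hX => ?_⟩
  letI instS : Algebra K[X] (Z'.presheaf.stalk x' ⧸ Ideal.span {(τ.stalkMap x').hom (![t, v] 1)}) :=
    ((eE.symm : _ →+* _).comp (@algebraMap K[X] (A'' ⧸ Ideal.span {v''}) _ _ instE)).toAlgebra
  have halgS : ∀ q : K[X], algebraMap K[X] (Z'.presheaf.stalk x' ⧸ Ideal.span {(τ.stalkMap x').hom (![t, v] 1)}) q =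
      eE.symm (@algebraMap K[X] (A'' ⧸ Ideal.span {v''}) _ _ instE q) := fun q => rfl
  obtain ⟨N, hN⟩ := hE K M₀ instS (fun g r hgr => by
      obtain ⟨r₀, hr₀⟩ := hrep g
      have hcls : Ideal.Quotient.mk (Ideal.span (Set.range ![t, v])) r = Ideal.Quotient.mk _ (Ψ r₀) := by rw [hgr, hcompat g r₀ hr₀]
      have hdiff : r - Ψ r₀ ∈ Ideal.span (Set.range ![t, v]) := by rw [← Ideal.Quotient.eq]; exact hcls
      have hdiff' : Ideal.Quotient.mk (Ideal.span {(τ.stalkMap x').hom (![t, v] 1)}) ((τ.stalkMap x').hom r) =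
          Ideal.Quotient.mk _ ((τ.stalkMap x').hom (Ψ r₀)) := by
        rw [Ideal.Quotient.eq, ← map_sub]; exact hleE hdiff
      rw [halgS, hcompatE g r₀ hr₀, hΨ'', hψ, heEsymm, e.symm_apply_apply, hdiff'])
    (by rw [halgS, hX, heEsymm])
  let eEa : (Z'.presheaf.stalk x' ⧸ Ideal.span {(τ.stalkMap x').hom (![t, v] 1)}) ≃ₐ[K[X]] (A'' ⧸ Ideal.span {v''}) :=
    { eE with
      commutes' := fun q => by
        change eE (algebraMap K[X] _ q) = _
        rw [halgS, RingEquiv.apply_symm_apply] }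
  exact ⟨N, @IsLocalization.isLocalization_of_algEquiv K[X] _ N _ _ _ _ _ instE hN eEa⟩

end TopTransport

/-! ## §3 The tower with an honest top -/

section Top

variable (d : ℕ) (Y : ℕ → Scheme.{u}) (τ : ∀ j, Y (j + 1) ⟶ Y j) (J : ∀ j, (Y j).IdealSheafData) (y : ∀ j, Y (j + 1))
  (e : ∀ j, (Y (j + 1)).presheaf.stalk (y j) ≃+* (Y (j + 1)).presheaf.stalk (τ (j + 1) (y (j + 1))))
  (ψ : ∀ j, (Y j).presheaf.stalk (τ j (y j)) →+* (Y (j + 1)).presheaf.stalk (τ (j + 1) (y (j + 1))))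
  (t v : ∀ j, (Y j).presheaf.stalk (τ j (y j)))
  {K : Type u} [CommRing K] (M₀ : Submonoid K)
  (Ψ : ∀ j, (Y 0).presheaf.stalk (τ 0 (y 0)) →+* (Y j).presheaf.stalk (τ j (y j)))
  (inst₀ : Algebra K ((Y 0).presheaf.stalk (τ 0 (y 0)) ⧸ Ideal.span (Set.range ![t 0, v 0])))

set_option maxHeartbeats 800000 in
-- long statement; elaboration only
/-- **THE σ-TOWER WITH AN HONEST TOP**: the hypotheses of ✓ `sigmaTower` for the levels `j < d` (the points `y_0, …, y_{d−1}` follow the leaf), the top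
blowing up `τ_d` of the σ-curve `(t_d, v_d)` read at an ARBITRARY point `y_d` of the `v`-chart (`ψ_d v_d = v_{d+1}`, `ψ_d t_d = v_{d+1} t_{d+1}`, no condition
on `t_{d+1}`).  Conclusion at level `d + 1`: `v_{d+1}` is a non-zero-divisor, `𝒪_{d+1}/(v_{d+1})` is local, and every compatible `K[T]`-structure on it with
`T ↦ t̄_{d+1}` is a localization of `K[T]`. [cite: StacksProject, Tag 0804, Tag 0BIQ] [cite: Matsumura1987, Thm. 4.1–4.3, Thm. 14.2]
[cite: CossartPiltant2008, Prop. 4.4 (proof, p. 11)] -/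
theorem sigmaTower_top (hτ : ∀ j < d + 1, IsBlowup (τ j) (J j)) (hψ : ∀ j < d + 1, ∀ r, ψ j r = e j (((τ j).stalkMap (y j)).hom r))
    (h0 : IsRsopPart ![t 0, v 0]) (hcJ : ∀ j < d + 1, Ideal.span (Set.range ![t j, v j]) = stalkIdeal (J j) (τ j (y j)))
    (hv : ∀ j < d + 1, ψ j (v j) = v (j + 1)) (ht : ∀ j < d + 1, ψ j (t j) = v (j + 1) * t (j + 1))
    (ht𝔪 : ∀ j < d, t (j + 1) ∈ maximalIdeal ((Y (j + 1)).presheaf.stalk (τ (j + 1) (y (j + 1)))))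
    (hΨ0 : ∀ r, Ψ 0 r = r) (hΨ : ∀ j < d + 1, ∀ r, Ψ (j + 1) r = ψ j (Ψ j r))
    (hloc₀ : @IsLocalization K _ M₀ ((Y 0).presheaf.stalk (τ 0 (y 0)) ⧸ Ideal.span (Set.range ![t 0, v 0])) _ inst₀) :
    v (d + 1) ∈ nonZeroDivisors ((Y (d + 1)).presheaf.stalk (τ (d + 1) (y (d + 1)))) ∧
      IsLocalRing ((Y (d + 1)).presheaf.stalk (τ (d + 1) (y (d + 1))) ⧸ Ideal.span {v (d + 1)}) ∧
      (∀ instE : Algebra K[X] ((Y (d + 1)).presheaf.stalk (τ (d + 1) (y (d + 1))) ⧸ Ideal.span {v (d + 1)}),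
        (∀ (g : K) (r₀ : (Y 0).presheaf.stalk (τ 0 (y 0))),
          @algebraMap K ((Y 0).presheaf.stalk (τ 0 (y 0)) ⧸ Ideal.span (Set.range ![t 0, v 0])) _ _ inst₀ g = Ideal.Quotient.mk _ r₀ →
          @algebraMap K[X] ((Y (d + 1)).presheaf.stalk (τ (d + 1) (y (d + 1))) ⧸ Ideal.span {v (d + 1)}) _ _ instE (C g) =
            Ideal.Quotient.mk _ (Ψ (d + 1) r₀)) →
        @algebraMap K[X] ((Y (d + 1)).presheaf.stalk (τ (d + 1) (y (d + 1))) ⧸ Ideal.span {v (d + 1)}) _ _ instE Polynomial.X =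
          Ideal.Quotient.mk _ (t (d + 1)) →
        ∃ N : Submonoid K[X], @IsLocalization K[X] _ N ((Y (d + 1)).presheaf.stalk (τ (d + 1) (y (d + 1))) ⧸ Ideal.span {v (d + 1)}) _ instE) := by
  obtain ⟨hrs, inst, hcompat, hloc⟩ := sigmaTower_inv d Y τ J y e ψ t v M₀ Ψ inst₀ (fun j hj => hτ j (by omega)) (fun j hj => hψ j (by omega)) h0
    (fun j hj => hcJ j (by omega)) (fun j hj => hv j (by omega)) (fun j hj => ht j (by omega)) ht𝔪 hΨ0 (fun j hj => hΨ j (by omega)) hloc₀ d le_rfl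
  exact sigmaTower_topStep (hτ d (lt_add_one d)) (y d) (t d) (v d) hrs (hcJ d (lt_add_one d)) (e d) (ψ d) (hψ d (lt_add_one d)) (t (d + 1)) (v (d + 1))
    (hv d (lt_add_one d)) (ht d (lt_add_one d)) M₀ (Ideal.span (Set.range ![t 0, v 0]))
    (@algebraMap K ((Y 0).presheaf.stalk (τ 0 (y 0)) ⧸ Ideal.span (Set.range ![t 0, v 0])) _ _ inst₀) (Ψ d) (Ψ (d + 1)) (hΨ d (lt_add_one d))
    inst hcompat hloc

end Top

/-! ## §4 STEP 1 end to end with the honest top -/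

section SuccessorTop

variable (d : ℕ) (Y : ℕ → Scheme.{u}) (τ : ∀ j, Y (j + 1) ⟶ Y j) (J : ∀ j, (Y j).IdealSheafData) (y : ∀ j, Y (j + 1))
  (e : ∀ j, (Y (j + 1)).presheaf.stalk (y j) ≃+* (Y (j + 1)).presheaf.stalk (τ (j + 1) (y (j + 1))))
  (ψ : ∀ j, (Y j).presheaf.stalk (τ j (y j)) →+* (Y (j + 1)).presheaf.stalk (τ (j + 1) (y (j + 1))))
  (t v : ∀ j, (Y j).presheaf.stalk (τ j (y j)))
  {k : Type u} [Field k] (M₀ : Submonoid k[X])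
  (Ψ : ∀ j, (Y 0).presheaf.stalk (τ 0 (y 0)) →+* (Y j).presheaf.stalk (τ j (y j)))
  (inst₀ : Algebra k[X] ((Y 0).presheaf.stalk (τ 0 (y 0)) ⧸ Ideal.span (Set.range ![t 0, v 0])))
  (μ : ℕ) (f : ∀ j, (Y j).presheaf.stalk (τ j (y j))) (h : ∀ j, ℕ → (Y j).presheaf.stalk (τ j (y j)))
  {R : Type*} [CommRing R] {σι : Type*} [Fintype σι] (τR : R →+* (Y 0).presheaf.stalk (τ 0 (y 0)))
  (uf : σι → (Y 0).presheaf.stalk (τ 0 (y 0))) (G : ℕ → MvPolynomial σι R) (σ : R →+* k) (yv : σι → k[X])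
  (instE : Algebra (k[X])[X] ((Y (d + 1)).presheaf.stalk (τ (d + 1) (y (d + 1))) ⧸ Ideal.span {v (d + 1)}))

set_option maxHeartbeats 800000 in
-- long statement; elaboration only
/-- **STEP 1 OF THE `δ`-DESCENT END TO END, HONEST TOP**: ✓ `sigmaTower_successor` with the leaf condition `t_{j+1} ∈ 𝔪` only BELOW the top (`j < d`);
the top point `y_d` (the generic point `η″` of the near curve, census (S3)) is any point of the `v`-chart over the tower.
[cite: CossartPiltant2008, Lemma 4.3 (5); Prop. 4.4 (proof, p. 11)] [cite: CossartJannsenSaito2020, Lemma 7.5] -/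
theorem sigmaTower_successor_top
    (hτ : ∀ j < d + 1, IsBlowup (τ j) (J j)) (hψ : ∀ j < d + 1, ∀ r, ψ j r = e j (((τ j).stalkMap (y j)).hom r))
    (h0 : IsRsopPart ![t 0, v 0]) (hcJ : ∀ j < d + 1, Ideal.span (Set.range ![t j, v j]) = stalkIdeal (J j) (τ j (y j)))
    (hv : ∀ j < d + 1, ψ j (v j) = v (j + 1)) (ht : ∀ j < d + 1, ψ j (t j) = v (j + 1) * t (j + 1))
    (ht𝔪 : ∀ j < d, t (j + 1) ∈ maximalIdeal ((Y (j + 1)).presheaf.stalk (τ (j + 1) (y (j + 1)))))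
    (hΨ0 : ∀ r, Ψ 0 r = r) (hΨ : ∀ j < d + 1, ∀ r, Ψ (j + 1) r = ψ j (Ψ j r))
    (hloc₀ : @IsLocalization k[X] _ M₀ ((Y 0).presheaf.stalk (τ 0 (y 0)) ⧸ Ideal.span (Set.range ![t 0, v 0])) _ inst₀)
    (hf : ∀ j < d + 1, v (j + 1) ^ μ * f (j + 1) = ψ j (f j)) (hh : ∀ j < d + 1, ∀ e', h (j + 1) e' = ψ j (h j e'))
    (h0f : f 0 = ∑ e' ∈ Finset.range (μ + 1), t 0 ^ e' * v 0 ^ ((μ - e') * (d + 1)) * h 0 e')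
    (hG : ∀ e', (G e').IsHomogeneous ((μ - e') * (d + 1 + 1)))
    (hh0 : ∀ e' ≤ μ, h 0 e' - MvPolynomial.eval₂ τR uf (G e') ∈ Ideal.span {v 0})
    (hΛC : ∀ r, @algebraMap k[X] ((Y 0).presheaf.stalk (τ 0 (y 0)) ⧸ Ideal.span (Set.range ![t 0, v 0])) _ _ inst₀ (C (σ r)) =
      Ideal.Quotient.mk _ (τR r))
    (hΛy : ∀ i, @algebraMap k[X] ((Y 0).presheaf.stalk (τ 0 (y 0)) ⧸ Ideal.span (Set.range ![t 0, v 0])) _ _ inst₀ (yv i) =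
      Ideal.Quotient.mk _ (uf i))
    (hy1 : ∀ i, (yv i).natDegree ≤ 1)
    (hEC : ∀ (g : k[X]) (r₀ : (Y 0).presheaf.stalk (τ 0 (y 0))),
      @algebraMap k[X] ((Y 0).presheaf.stalk (τ 0 (y 0)) ⧸ Ideal.span (Set.range ![t 0, v 0])) _ _ inst₀ g = Ideal.Quotient.mk _ r₀ →
      @algebraMap (k[X])[X] ((Y (d + 1)).presheaf.stalk (τ (d + 1) (y (d + 1))) ⧸ Ideal.span {v (d + 1)}) _ _ instE (C g) =
        Ideal.Quotient.mk _ (Ψ (d + 1) r₀))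
    (hEX : @algebraMap (k[X])[X] ((Y (d + 1)).presheaf.stalk (τ (d + 1) (y (d + 1))) ⧸ Ideal.span {v (d + 1)}) _ _ instE Polynomial.X =
      Ideal.Quotient.mk _ (t (d + 1)))
    [IsLocalRing ((Y (d + 1)).presheaf.stalk (τ (d + 1) (y (d + 1))) ⧸ Ideal.span {v (d + 1)})]
    (hμ : 1 ≤ μ) (hc : σ (MvPolynomial.coeff 0 (G μ)) ≠ 0) (hδ : ((d + 1 + 1 : ℕ) : k) = 0)
    (hCu : ∀ g : k[X], g ≠ 0 →
      IsUnit (@algebraMap (k[X])[X] ((Y (d + 1)).presheaf.stalk (τ (d + 1) (y (d + 1))) ⧸ Ideal.span {v (d + 1)}) _ _ instE (C g)))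
    (hne : (maximalIdeal ((Y (d + 1)).presheaf.stalk (τ (d + 1) (y (d + 1))) ⧸ Ideal.span {v (d + 1)})).comap
      (@algebraMap (k[X])[X] ((Y (d + 1)).presheaf.stalk (τ (d + 1) (y (d + 1))) ⧸ Ideal.span {v (d + 1)}) _ _ instE) ≠ ⊥)
    (hΦ : Ideal.Quotient.mk (Ideal.span {v (d + 1)}) (f (d + 1)) ∈
      maximalIdeal ((Y (d + 1)).presheaf.stalk (τ (d + 1) (y (d + 1))) ⧸ Ideal.span {v (d + 1)}) ^ μ) :
    ∃ (π : (k[X])[X]) (a : k) (lam : k[X]), Prime π ∧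
      (maximalIdeal ((Y (d + 1)).presheaf.stalk (τ (d + 1) (y (d + 1))) ⧸ Ideal.span {v (d + 1)})).comap
        (@algebraMap (k[X])[X] ((Y (d + 1)).presheaf.stalk (τ (d + 1) (y (d + 1))) ⧸ Ideal.span {v (d + 1)}) _ _ instE) = Ideal.span {π} ∧
      a ≠ 0 ∧ π = C (C a) * (X + C lam) ∧
      (∑ e' ∈ Finset.range (μ + 1), (X : (k[X])[X]) ^ e' * C (MvPolynomial.eval₂ ((C : k →+* k[X]).comp σ) yv (G e'))) =
        C (C (σ (MvPolynomial.coeff 0 (G μ)))) * (X + C lam) ^ μ ∧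
      lam.natDegree ≤ d + 1 + 1 ∧ (derivative lam).natDegree ≤ d + 1 + 1 - 2 ∧
      Ideal.Quotient.mk (Ideal.span {v (d + 1)}) (f (d + 1)) =
        @algebraMap (k[X])[X] ((Y (d + 1)).presheaf.stalk (τ (d + 1) (y (d + 1))) ⧸ Ideal.span {v (d + 1)}) _ _ instE
          (C (C (σ (MvPolynomial.coeff 0 (G μ)))) * (X + C lam) ^ μ) := by
  letI := instE
  -- `hvnzd` below the top from the chained tower, at the top from the top storey; the `K[T]`-localization of `S` from the top storey
  have hbelow := sigmaTower d Y τ J y e ψ t v M₀ Ψ inst₀ (fun j hj => hτ j (by omega)) (fun j hj => hψ j (by omega)) h0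
    (fun j hj => hcJ j (by omega)) (fun j hj => hv j (by omega)) (fun j hj => ht j (by omega)) ht𝔪 hΨ0 (fun j hj => hΨ j (by omega)) hloc₀
  obtain ⟨hnzdtop, -, hE⟩ := sigmaTower_top d Y τ J y e ψ t v M₀ Ψ inst₀ hτ hψ h0 hcJ hv ht ht𝔪 hΨ0 hΨ hloc₀
  have hvnzd : ∀ j < d + 1, v (j + 1) ∈ nonZeroDivisors ((Y (j + 1)).presheaf.stalk (τ (j + 1) (y (j + 1)))) := by
    intro j hj
    by_cases hjd : j < d
    · exact (hbelow j hjd).2.1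
    · obtain rfl : j = d := by omega
      exact hnzdtop
  have hN := hE instE hEC hEX
  -- the cocone `ε = mk`, `ε₀ = mk ∘ Ψ_{d+1}`
  have hhd : ∀ e' ≤ μ, Ideal.Quotient.mk (Ideal.span {v (d + 1)}) (h (d + 1) e') =
      ((Ideal.Quotient.mk (Ideal.span {v (d + 1)})).comp (Ψ (d + 1))) (h 0 e') := fun e' _ => by
    rw [RingHom.comp_apply,
      comp_eq_of_tower (fun j => (Y j).presheaf.stalk (τ j (y j))) ψ (d + 1) Ψ hΨ0 hΨ (fun j => h j e') (fun j hj => hh j hj e') (d + 1) le_rfl]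
  have hv0 : ((Ideal.Quotient.mk (Ideal.span {v (d + 1)})).comp (Ψ (d + 1))) (v 0) = 0 := by
    rw [RingHom.comp_apply, comp_v_eq_of_tower (fun j => (Y j).presheaf.stalk (τ j (y j))) ψ (d + 1) Ψ hΨ0 hΨ v hv (d + 1) le_rfl,
      Ideal.Quotient.eq_zero_iff_mem]
    exact Ideal.mem_span_singleton_self _
  have hεv : Ideal.Quotient.mk (Ideal.span {v (d + 1)}) (v (d + 1)) = 0 :=
    Ideal.Quotient.eq_zero_iff_mem.mpr (Ideal.mem_span_singleton_self _)
  have hσ : ∀ r, ((Ideal.Quotient.mk (Ideal.span {v (d + 1)})).comp (Ψ (d + 1))) (τR r) =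
      algebraMap (k[X])[X] _ (C (C (σ r))) := fun r => by
    rw [RingHom.comp_apply, hEC (C (σ r)) (τR r) (hΛC r)]
  have hy : ∀ i, ((Ideal.Quotient.mk (Ideal.span {v (d + 1)})).comp (Ψ (d + 1))) (uf i) = algebraMap (k[X])[X] _ (C (yv i)) := fun i => by
    rw [RingHom.comp_apply, hEC (yv i) (uf i) (hΛy i)]
  obtain ⟨hface, hdeg, htop, hC0⟩ := tower_face_of_lt (fun j => (Y j).presheaf.stalk (τ j (y j))) ψ μ (d + 1) t v f h τR uf G
    ((Ideal.Quotient.mk (Ideal.span {v (d + 1)})).comp (Ψ (d + 1))) (Ideal.Quotient.mk (Ideal.span {v (d + 1)})) σ yv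
    hv hvnzd ht hf hh h0f hG hh0 hhd hv0 hεv hEX.symm hσ hy hy1
  have hΦ' : algebraMap (k[X])[X] ((Y (d + 1)).presheaf.stalk (τ (d + 1) (y (d + 1))) ⧸ Ideal.span {v (d + 1)})
      (∑ e' ∈ Finset.range (μ + 1), (X : (k[X])[X]) ^ e' * C (MvPolynomial.eval₂ ((C : k →+* k[X]).comp σ) yv (G e'))) ∈
      maximalIdeal _ ^ μ := by rw [← hface]; exact hΦ
  obtain ⟨π, a, lam, hπ, hcomap, ha, hπeq, hΦeq, hlam, hlam'⟩ :=
    exists_successor_of_exists_isLocalization hN hCu hne hμ hdeg hc htop hC0 hδ hΦ'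
  exact ⟨π, a, lam, hπ, hcomap, ha, hπeq, hΦeq, hlam, hlam', by rw [hface, hΦeq]⟩

end SuccessorTop

end Summit.ResolutionOfSingularities.ResolutionOfSingularities.Theorems.RadicialJung.CleanModels

end
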